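import Summits.CriticalPhenomena.PercolationContinuityZ3.Theorems.PercNearOneGluingNoHeavyLowerTailSahiCombFiveUpSetTriWCube

/-!
# The one-cube triangle functional `TRI_W(a)` for a shared block of ANY size: definition, pair decomposition, the co-nested case, and the typed open target

Support file of the one-cut programme (crux `NoHeavyLowerTail`, stmt-CriticalPhenomena-4575; cell `prim-masterthm`, seat P5 gen 10;
report `P5-LORENTZIAN-TEST.md` §11.10, §13.8, §14, §15; memos `FROM-prim-masterthm-p5-g9-RANKZA-CERT.md`, `FROM-prim-masterthm-p5-g10-TWO-COPY-STRUCTURE.md`).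

The triangle-class coefficient of (M⁺⁺-3) on a cell `(a,b,c)` is the one-cube functional `TRI_W(a)` of report §11.10: for a cube
`W = Finset γ` (antipode `refl` = complementation), an up-set `P ⊆ W` and two increasing families `F, G : Finset β → up-sets of W`
indexed by the small cube `X = Finset β` (antipode `x ↦ xᶜ`), with `U_x = F x ∩ G x`,
`TRI_W(a)(P) = Σ_x [ 2·#(P ∩ U_x) − #(P ∩ refl(F x) ∩ G xᶜ) − #(P ∩ F x ∩ refl(G xᶜ)) − #(P ∩ refl(F x) ∩ refl(G x)) + #(P ∩ refl(F x) ∩ refl(G xᶜ)) ]`.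
For `Fintype.card β = 1` this is the thin-edge functional `LatticeFiveUpSet.triWOne` (a = 1), non-negative by `FiveUpSet.triWOne_nonneg_cube`.

* `FiveUpSet.triWTerm`, `FiveUpSet.triW` — the summand at `x` and `TRI_W(a)`;
* `FiveUpSet.triWTerm_add_compl` — the two summands of an antipodal pair `{x, xᶜ}` add up to `triWOne (F x) (F xᶜ) (G x) (G xᶜ)`;
* `FiveUpSet.two_mul_triW` — `2 · TRI_W(a) = Σ_x triWOne compl P (F x) (F xᶜ) (G x) (G xᶜ)` (pair decomposition, report §13.10);
* **`FiveUpSet.triW_nonneg_of_pairwise_nested`** — if along every antipodal pair the two families are CO-NESTED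
  (`F x ⊆ F xᶜ ∧ G x ⊆ G xᶜ` or the reverse), then `0 ≤ triW P F G` for all up-sets; this contains the thin edge (`a = 1`) and every pair of
  families that depends on `x` only through a common chain statistic (e.g. `#x`), for every `a` — unconditional (five-up-set theorem + Kleitman);
* `FiveUpSet.TriWIneq` (`@[conjecture]`) — the OPEN target for `a ≥ 2`: `0 ≤ triW P F G` for all monotone up-set families.  Census (report §13.6,
  §14, §15): exhaustive `(n,a) = (2,2), (3,2)` [1.15e9 instances], exact-min exhaustive `(4,2), (3,3)`, sampled `(2,4), (4,3), (3,4), (5,2)`: 0 negative;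
  explicit two-copy rank certificates verified exhaustively through `(3,2)` (kit j115006).
HONEST LABEL: a definition, two identities, one easy unconditional stratum, and a typed conjecture; `TriWIneq` itself is OPEN and NOT proved here. [this work]
-/

namespace Summit.CriticalPhenomena.PercolationContinuityZ3.Theorems

namespace FiveUpSet

open Finset

variable {β γ : Type} [DecidableEq β] [Fintype β] [DecidableEq γ] [Fintype γ]

/-- The complementation antipode of the cube `Finset γ` as an equivalence (the `τ` of `LatticeFiveUpSet.triWOne`). [this work] -/
def complEquiv (γ : Type) [DecidableEq γ] [Fintype γ] : Finset γ ≃ Finset γ := ⟨compl, compl, compl_compl, compl_compl⟩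

omit [DecidableEq β] [Fintype β] in
/-- `image` under the complementation equivalence is `refl`. [this work] -/
theorem image_complEquiv (𝒜 : Finset (Finset γ)) : 𝒜.image (complEquiv γ) = refl 𝒜 := by
  ext s
  rw [mem_refl, mem_image]
  constructor
  · rintro ⟨t, ht, rfl⟩
    simpa [complEquiv] using ht
  · intro hs
    exact ⟨sᶜ, hs, compl_compl s⟩

/-- The summand of `TRI_W(a)` at the index `x ∈ Finset β` (report §11.10, §13.8: `2A_x − B₁ − B₂ − B₃ + C` at `x`):
`2·#(P ∩ F x ∩ G x) − #(P ∩ refl(F x) ∩ G xᶜ) − #(P ∩ F x ∩ refl(G xᶜ)) − #(P ∩ refl(F x) ∩ refl(G x)) + #(P ∩ refl(F x) ∩ refl(G xᶜ))`. [this work] -/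
def triWTerm (P : Finset (Finset γ)) (F G : Finset β → Finset (Finset γ)) (x : Finset β) : ℤ :=
  2 * ((P ∩ F x ∩ G x).card : ℤ) - (P ∩ refl (F x) ∩ G xᶜ).card - (P ∩ F x ∩ refl (G xᶜ)).card
    - (P ∩ refl (F x) ∩ refl (G x)).card + (P ∩ refl (F x) ∩ refl (G xᶜ)).card

/-- **`TRI_W(a)`** — the one-cube triangle functional for a shared block `Finset β` of any size (report §11.10):
`triW P F G = Σ_{x : Finset β} triWTerm P F G x`.  For cylinders `W = 2^b × 2^c`, `F x = f(x,·) × 2^c`, `G x = 2^b × g(x,·)`, `P = h`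
this is the triangle-class coefficient `TRI(a,b,c)(f,g,h)` of (M⁺⁺-3) (report §10.3, §11.10). [this work] -/
def triW (P : Finset (Finset γ)) (F G : Finset β → Finset (Finset γ)) : ℤ :=
  ∑ x : Finset β, triWTerm P F G x

/-- The two summands of an antipodal pair add up to the thin-edge functional of the (not necessarily nested) pairs
`(F x, F xᶜ)`, `(G x, G xᶜ)`: `triWTerm x + triWTerm xᶜ = triWOne compl P (F x) (F xᶜ) (G x) (G xᶜ)`. [this work] -/
theorem triWTerm_add_compl (P : Finset (Finset γ)) (F G : Finset β → Finset (Finset γ)) (x : Finset β) :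
    triWTerm P F G x + triWTerm P F G xᶜ
      = LatticeFiveUpSet.triWOne (complEquiv γ) P (F x) (F xᶜ) (G x) (G xᶜ) := by
  unfold triWTerm LatticeFiveUpSet.triWOne
  simp only [image_complEquiv, compl_compl]
  ring

/-- **Pair decomposition** (report §13.10/§15): `2 · triW P F G = Σ_x triWOne compl P (F x) (F xᶜ) (G x) (G xᶜ)`
(each antipodal pair `{x, xᶜ}` is counted twice on both sides). [this work] -/
theorem two_mul_triW (P : Finset (Finset γ)) (F G : Finset β → Finset (Finset γ)) :
    2 * triW P F G = ∑ x : Finset β, LatticeFiveUpSet.triWOne (complEquiv γ) P (F x) (F xᶜ) (G x) (G xᶜ) := by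
  unfold triW
  have hre : ∑ x : Finset β, triWTerm P F G xᶜ = ∑ x : Finset β, triWTerm P F G x :=
    Fintype.sum_equiv (complEquiv β) _ _ (fun x => rfl)
  calc 2 * ∑ x : Finset β, triWTerm P F G x
      = ∑ x : Finset β, triWTerm P F G x + ∑ x : Finset β, triWTerm P F G xᶜ := by rw [hre]; ring
    _ = ∑ x : Finset β, (triWTerm P F G x + triWTerm P F G xᶜ) := by rw [← sum_add_distrib]
    _ = ∑ x : Finset β, LatticeFiveUpSet.triWOne (complEquiv γ) P (F x) (F xᶜ) (G x) (G xᶜ) := by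
        refine sum_congr rfl fun x _ => ?_
        exact triWTerm_add_compl P F G x

/-- **`TRI_W(a) ≥ 0` when the two families are co-nested along every antipodal pair** (unconditional, every `a`).  If for every
`x` either `F x ⊆ F xᶜ ∧ G x ⊆ G xᶜ` or `F xᶜ ⊆ F x ∧ G xᶜ ⊆ G x`, then `0 ≤ triW P F G` for all up-sets `P`, `F x`, `G x`.  Each pair term
is a thin-edge functional of NESTED pairs, non-negative by the five-up-set theorem (`triWOne_nonneg_cube`).  Covers `a = 1` (the thin edge) and
all pairs of monotone families factoring through a common chain statistic of `x` (e.g. `F x = Φ(#x)`, `G x = Ψ(#x)`).  It does NOT cover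
general monotone families for `a ≥ 2` (`F x`, `F xᶜ` incomparable), which is `TriWIneq`. [this work] -/
theorem triW_nonneg_of_pairwise_nested (P : Finset (Finset γ)) (F G : Finset β → Finset (Finset γ))
    (hP : IsUpperSet (P : Set (Finset γ))) (hF : ∀ x, IsUpperSet (F x : Set (Finset γ)))
    (hG : ∀ x, IsUpperSet (G x : Set (Finset γ)))
    (hnest : ∀ x, (F x ⊆ F xᶜ ∧ G x ⊆ G xᶜ) ∨ (F xᶜ ⊆ F x ∧ G xᶜ ⊆ G x)) :
    0 ≤ triW P F G := by
  have h2 : 0 ≤ 2 * triW P F G := by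
    rw [two_mul_triW]
    refine sum_nonneg fun x _ => ?_
    rcases hnest x with ⟨hFx, hGx⟩ | ⟨hFx, hGx⟩
    · exact triWOne_nonneg_cube γ P (F x) (F xᶜ) (G x) (G xᶜ) hP (hF x) (hF xᶜ) (hG x) (hG xᶜ) hFx hGx
    · -- swap the roles inside the pair: `triWOne` is symmetric under `(F₀,F₁,G₀,G₁) ↦ (F₁,F₀,G₁,G₀)`
      have hsym : LatticeFiveUpSet.triWOne (complEquiv γ) P (F x) (F xᶜ) (G x) (G xᶜ)
          = LatticeFiveUpSet.triWOne (complEquiv γ) P (F xᶜ) (F x) (G xᶜ) (G x) := by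
        unfold LatticeFiveUpSet.triWOne; ring
      rw [hsym]
      exact triWOne_nonneg_cube γ P (F xᶜ) (F x) (G xᶜ) (G x) hP (hF xᶜ) (hF x) (hG xᶜ) (hG x) hFx hGx
  omega

/-- The thin edge as a special case: if `Finset β` has exactly the two elements `∅, univ` (`Fintype.card β = 1`), monotone families are
pairwise nested, so `0 ≤ triW P F G`. [this work] -/
theorem triW_nonneg_of_card_eq_one (hβ : Fintype.card β = 1) (P : Finset (Finset γ)) (F G : Finset β → Finset (Finset γ))
    (hP : IsUpperSet (P : Set (Finset γ))) (hF : ∀ x, IsUpperSet (F x : Set (Finset γ)))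
    (hG : ∀ x, IsUpperSet (G x : Set (Finset γ))) (hFm : Monotone F) (hGm : Monotone G) :
    0 ≤ triW P F G := by
  refine triW_nonneg_of_pairwise_nested P F G hP hF hG fun x => ?_
  -- with one coordinate, `x = ∅` or `x = univ`
  have hx : x = ∅ ∨ x = univ := by
    by_cases h : x = ∅
    · exact Or.inl h
    · right
      obtain ⟨b, hb⟩ := Finset.nonempty_iff_ne_empty.2 h
      have hsub : (univ : Finset β) ⊆ {b} := by
        intro c _
        rw [mem_singleton]
        exact Fintype.card_le_one_iff.1 hβ.le c b
      exact eq_univ_of_forall fun c => by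
        have := hsub (mem_univ c)
        rw [mem_singleton] at this
        rw [this]; exact hb
  rcases hx with rfl | rfl
  · left
    exact ⟨hFm (empty_subset _), hGm (empty_subset _)⟩
  · right
    rw [compl_univ]
    exact ⟨hFm (empty_subset _), hGm (empty_subset _)⟩

/-! ### The open target -/

/-- **`TRI_W(a) ≥ 0` for every `a`** (CONJECTURE — an obligation of our theory, never a fact; report §11.10/§15).  For finite cubes `Finset β`
(shared block) and `Finset γ` (the other two blocks, or any cube), an up-set `P` and MONOTONE families `F, G` of up-sets:
`0 ≤ triW P F G`.  Equivalent (Strassen/Hall) to a `W`-monotone injection of the demand tokens into two copies of `⊔_x (P ∩ F x ∩ G x)`;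
⟹ (M⁺⁺-3) on the whole triangle class via `SahiHybrid.hybCoeff_eq_tri` (the cylinder transport for general `a` is not in the tree).
Known: `a ≤ 1` and the co-nested stratum (`triW_nonneg_of_pairwise_nested`); census-clean on every cell with `n + a ≤ 7` tested
(exhaustive (2,2),(3,2), exact-min (4,2),(3,3)); two-copy rank certificates exhaustive through (3,2) (memo TWO-COPY-STRUCTURE). OPEN for `a ≥ 2`. [this work] -/
@[conjecture] def TriWIneq : Prop :=
  ∀ (β γ : Type) [DecidableEq β] [Fintype β] [DecidableEq γ] [Fintype γ]
    (P : Finset (Finset γ)) (F G : Finset β → Finset (Finset γ)),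
    IsUpperSet (P : Set (Finset γ)) → (∀ x, IsUpperSet (F x : Set (Finset γ))) → (∀ x, IsUpperSet (G x : Set (Finset γ))) →
    Monotone F → Monotone G → 0 ≤ triW P F G

end FiveUpSet

end Summit.CriticalPhenomena.PercolationContinuityZ3.Theorems
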